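import Summits.BirchSwinnertonDyer.BirchSwinnertonDyer.Theorems.AlignedTransportAtTwoMainConjectureOfRankZeroBSDAtTwoHalfDescentBaseIndexSelmer
import Summits.BirchSwinnertonDyer.BirchSwinnertonDyer.Theorems.AlignedTransportAtTwoMainConjectureOfRankZeroBSDAtTwoHalfDescentLayerIndexGrowthFiniteCell
import Summits.BirchSwinnertonDyer.BirchSwinnertonDyer.Theorems.ByReductionTypeAtTwoTorsionEulerCharH46
import Literature.NumberTheory.EllipticCurves.IwasawaEulerCharRankZeroAssemblyProofs
import Literature.NumberTheory.EllipticCurves.IwasawaSelmerControlOfLayerKernelsProofs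
import Literature.NumberTheory.EllipticCurves.BSDQuadraticDescentTorsionOddPartProofs
import HarnessLib

/-!
# Route `AlignedTransportAtTwo`, crux C2 `MainConjectureOfRankZeroBSDAtTwo` (stmt-BirchSwinnertonDyer-22298):
# THE BASE TERM CARRIES `p^μ`, XI — THE EULER BRIDGE: over `ℚ` at a good ORDINARY prime `p` (ANY `p`), the base term of the whole lineage in CLOSED FORM —
# `ord_p f_X(0) + 2·ord_p #W(ℚ)[p^∞] = ord_p Tam(W) + 2·ord_p #W̃(𝔽_p)[p^∞] + ord_p #Sel_{p^∞}(W/ℚ)` EXACTLY, hence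
# `#Sel_{p^∞}(W/ℚ_∞)^Γ · #W(ℚ)[p^∞]² = p^{ord_p Tam}·#W̃(𝔽_p)[p^∞]²·#Sel_{p^∞}(W/ℚ)·#(F/TF)`, `μ + 2t ≤ 𝔢 := v + 2e + s` with EQUALITY iff `λ = 0`,
# and the honest base number `#Sel_{p^∞}(W/ℚ)·#ker g_0·#W(ℚ)[p^∞]² = p^{𝔢}·#(F/TF)·#ker h_0`

HONEST FRAMING (cell `bsd-f1-sign2`, WIDTH-5 attached prover seat `bsd-line-att-p5` gen 61 on line `birth` of the lead `bsd-line-att-p2`;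
`--supports` stmt-BirchSwinnertonDyer-22298, closes nothing; BSD is NOT proved by any of this; the crux C2, its verdict «blocked-on
`Rank1Residual.GreenbergMuConjectureIrreducible`» and every registered stub (P / T / Kμ / LimDoor / MuIneqʳ / PFμ⁺) are untouched). THEOREMS ONLY — no `def`,
no instance, no named fact, no `sorry`; NO print binder (Greenberg's Thm. 4.1 at every good ordinary `p`, `2` included, is the tree's KERNEL theorem
`TorsionEulerChar.H46.charValue_rankZero`, cell bsd-2adic; the datum is `Λ`-torsion by the tree's `SelmerDualData.isTorsion_of_finite_selmerGroup_rat`).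
This is gen 60's successor (ii) «bridge to the Euler characteristic in Selmer currency»: gens 54–60 carried the base factor `#(X/TX) = #Sel_{p^∞}(E/K_∞)^Γ = p^{ord_p f_X(0)}·#(F/TF)`
(`…BaseIndexSelmer.natCard_selmerInvariants_zero_eq_pow_mul`) with `ord_p f_X(0)` unevaluated; here it is EVALUATED over `ℚ`.
HONESTY / DEDUP: gen 38 `…CyclotomicLayerWeightEuler.norm_constantCoeff_charGen_eq_of_thm41` has `‖f_X(0)‖ = p^{−(v+2e+s−2t)}` modulo the (now proved) print binder `hGr` and with the
exponents `t, e, s` taken as data; gen 46 `…TwistSaturation` has `rank W₂ + μ + 2t ≤ v + 2e + s` at `p = 2`. NEW here: the valuation identity stated print-free at every `p` with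
`padicValNat` of the honest cardinalities (no exponent data, no `IsCyclotomicVariable`), the base term and the honest base number in closed form, and «`μ + 2t = 𝔢 ⟺ λ = 0`».

Notation in the docstrings: `t = ord_p #W(ℚ)[p^∞]`, `e = ord_p #W̃(𝔽_p)[p^∞]`, `s = ord_p #Sel_{p^∞}(W/ℚ)`, `v = ord_p Tam(W) = ord_p ∏_ℓ c_ℓ`, `𝔢 = v + 2e + s`; `F ≤ X` a finite submodule with
`X/F` free of finite submodules (the maximal finite submodule), `#(F/TF)` its `T`-coinvariant order (`= 1` when `F = 0`).

* §1 ★★★ `constantCoeff_ne_zero_and_valuation_add_eq`: for ANY generator `f_X` of `char_Λ X(W/ℚ_∞)`: `f_X(0) ≠ 0`, `#W(ℚ)[p^∞]` is finite (as a by-product of the display), and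
  **`ord_p f_X(0) + 2t = v + 2e + s`**.
* §2 ★★★ `natCard_selmerInvariants_zero_mul_pow_eq`: **`#Sel_{p^∞}(W/ℚ_∞)^Γ · p^{2t} = p^{v+2e+s} · #(F/TF)`**; ★★ `natCard_selmer_mul_kerG_zero_mul_pow_eq`:
  **`#Sel_{p^∞}(W/ℚ) · #ker g_0 · p^{2t} = p^{v+2e+s} · #(F/TF) · #ker h_0`** (Lemma 4.3 at the base, tree).
* §3 ★★★ `mu_add_le`: **`μ(X(W/ℚ_∞)) + 2t ≤ v + 2e + s`**; ★★★ `mu_add_eq_iff_lambda_eq_zero`: **`μ + 2t = v + 2e + s ⟺ λ(X(W/ℚ_∞)) = 0`**; ★★ `mu_add_lt_of_lambda_ne_zero`: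
  `λ ≠ 0 ⟹ μ + 2t < v + 2e + s`.
* §4 THE CELL `W(ℚ)[p] = 0` (`t = 0`, `#ker h_0 = 1`): ★★ `natCard_selmerInvariants_zero_eq_cell` (`#Sel_∞^Γ = p^{v+2e+s}·#(F/TF)`), ★★ `natCard_selmer_mul_kerG_zero_eq_cell`
  (`#Sel_{p^∞}(W/ℚ)·#ker g_0 = p^{v+2e+s}·#(F/TF)`), ★★ `mu_le_cell` (`μ ≤ v + 2e + s`, `= ⟺ λ = 0`).
* §5 `p = 2`, the SEED CELL of C2 (good ordinary at `2`, no rational `2`-torsion abscissa — C2's own binder): `2` is anomalous, `e = ord₂ #W̃(𝔽₂) ≥ 1`, so ★★ `pow_dvd_natCard_selmer_mul_kerG_zero_two`: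
  **`2^{v+s+2} ∣ #Sel_{2^∞}(W/ℚ)·#ker g_0`**, in particular `#Sel_{2^∞}(W/ℚ)·#ker g_0 ≥ 4 > 2^{2^0}`: the lineage's `γ`-free door (`…BaseIndexSelmer.mu_eq_zero_of_natCard_selmerLayer_mul_kerG_pos_lt`)
  is SHUT AT THE BASE for every seed — numbers, not adjectives; and ★★ `mu_le_seed`: **`μ₂(W) ≤ v + 2·ord₂ #W̃(𝔽₂) + s`, with equality iff `λ₂(W) = 0`** (under Mazur's main conjecture
  `λ₂ = λ_an ≥ 1` and `μ₂ = 0`; a seed with `λ₂ = 0` would have `μ₂ = 𝔢 ≥ 2` and refute C2 — the dichotomy the next lead's certificate must decide).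
Nothing numerical is asserted about any curve; C2 untouched. Memo `Cruxes/MainConjectureOfRankZeroBSDAtTwo/EULER-BRIDGE-att-p5-g61.md`.

References: R. Greenberg, LNM 1716 (1999), Conj. 1.11, Thm. 1.4, §4 Thm. 4.1 (p. 102), Lemmas 4.2–4.3 (p. 103), Lemmas 4.6–4.7 [GreenbergLNM1716]; L. Washington, GTM 83, §13.2–13.3
[Washington1997]; B. Mazur, Invent. Math. 18 (1972) §6 [Mazur1972].
-/

set_option linter.dupNamespace false
set_option autoImplicit false

noncomputable section

open scoped Classical Polynomial

namespace Summit.BirchSwinnertonDyer.BirchSwinnertonDyer.Theorems.AlignedTransportAtTwoHalfDescentBaseIndexEuler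

open WeierstrassCurve Literature.NumberTheory.EllipticCurves Literature.NumberTheory.EllipticCurves.IwasawaAlgebra
  Literature.NumberTheory.EllipticCurves.Rank1Residual
  Summit.BirchSwinnertonDyer.Rank1Residual.X1.MuLambda
  Summit.BirchSwinnertonDyer.Rank1Residual.X1.MuPart
  Summit.BirchSwinnertonDyer.Rank1Residual.X1.ParitySqueeze
  Summit.BirchSwinnertonDyer.Rank1Residual.X1.GeneratorBoundMu
  Summit.BirchSwinnertonDyer.Rank1Residual.Iwasawa
  Summit.BirchSwinnertonDyer.BirchSwinnertonDyer.Theorems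
  Summit.BirchSwinnertonDyer.BirchSwinnertonDyer.Theorems.AlignedTransportAtTwoHalfDescentBaseRing
  Summit.BirchSwinnertonDyer.BirchSwinnertonDyer.Theorems.AlignedTransportAtTwoHalfDescentBaseIndex
  Summit.BirchSwinnertonDyer.BirchSwinnertonDyer.Theorems.AlignedTransportAtTwoHalfDescentBaseIndexSelmer
  Summit.BirchSwinnertonDyer.BirchSwinnertonDyer.Theorems.AlignedTransportAtTwoHalfDescentLayerIndexGrowthFiniteCell

variable (W : WeierstrassCurve ℚ) [W.IsElliptic] [W.IsGloballyMinimal] {p : ℕ} [hp : Fact p.Prime] (κ : ZpExtension ℚ p)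
  {γ : Field.absoluteGaloisGroup ℚ}

/-- A unit of `ℤ_p` has `p`-adic valuation `0` in `ℚ_p`. [folklore] -/
private theorem valuation_coe_units (u : ℤ_[p]ˣ) : ((u : ℤ_[p]) : ℚ_[p]).valuation = 0 := by
  have hu1 : ‖(u : ℤ_[p])‖ = 1 := PadicInt.isUnit_iff.mp u.isUnit
  have hne : (u : ℤ_[p]) ≠ 0 := u.ne_zero
  have h := PadicInt.norm_eq_zpow_neg_valuation hne
  rw [hu1, eq_comm, zpow_eq_one_iff_right₀ (by exact_mod_cast hp.out.pos.le) (by exact_mod_cast hp.out.one_lt.ne')] at h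
  rw [PadicInt.valuation_coe]
  omega

/-- The datum is `Λ`-torsion on the good ordinary rank-`0` locus over `ℚ` (tree: Mazur's control theorem at level `0`). [cite: GreenbergLNM1716, Thm. 1.4 (p. 60)] -/
private theorem isTorsion (hgo : GoodOrd W p) (hκ : κ.IsCyclotomic) (hγ : κ.IsTopGenerator γ) (D : W.SelmerDualData κ γ) (hfin : Finite (W.selmerGroupPInfty p)) :
    D.IsTorsion :=
  D.isTorsion_of_finite_selmerGroup_rat hκ (W.hasGoodReductionAt_and_hasUnitRootAt_of_rat hgo.1 hgo.2) hγ hfin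

/-! ## §1 The valuation of `f_X(0)`: Greenberg's Theorem 4.1 in exponents, print-free -/

section Valuation

/-- ★★★ **`f_X(0) ≠ 0`, `#W(ℚ)[p^∞]` is finite, and `ord_p f_X(0) + 2·ord_p #W(ℚ)[p^∞] = ord_p Tam(W) + 2·ord_p #W̃(𝔽_p)[p^∞] + ord_p #Sel_{p^∞}(W/ℚ)`** — `W/ℚ` globally minimal with
good ORDINARY reduction at `p` (ANY prime `p`), `κ` cyclotomic with topological generator `γ`, `D` ANY Pontryagin-dual datum of `Sel_{p^∞}(W/ℚ_∞)` with `char_Λ X = (f_X)`, `Sel_{p^∞}(W/ℚ)`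
finite. Greenberg's Thm. 4.1 display `f_X(0)·#W(ℚ)[p^∞]² = u·p^{v}·#W̃(𝔽_p)[p^∞]²·#Sel` (tree kernel theorem `TorsionEulerChar.H46.charValue_rankZero`) read through `Padic.valuation`.
[cite: GreenbergLNM1716, §4 Thm. 4.1 (p. 102) and Lemmas 4.6–4.7] -/
theorem constantCoeff_ne_zero_and_valuation_add_eq (hgo : GoodOrd W p) (hκ : κ.IsCyclotomic) (hγ : κ.IsTopGenerator γ) (D : W.SelmerDualData κ γ)
    [hSel : Finite (W.selmerGroupPInfty p)] {fX : IwasawaAlgebra p} (hchar : D.charIdeal = Ideal.span {fX}) :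
    PowerSeries.constantCoeff fX ≠ 0 ∧ Nat.card (AddCommGroup.primaryComponent W.toAffine.Point p) ≠ 0 ∧
      (PowerSeries.constantCoeff fX).valuation + 2 * padicValNat p (Nat.card (AddCommGroup.primaryComponent W.toAffine.Point p)) =
        padicValNat p W.tamagawaProduct + 2 * padicValNat p (Nat.card (AddCommGroup.primaryComponent ((integralModelInt W).map (Int.castRingHom (ZMod p))).toAffine.Point p)) +
          padicValNat p (Nat.card (W.selmerGroupPInfty p)) := by
  obtain ⟨u, hu⟩ := TorsionEulerChar.H46.charValue_rankZero p W hgo κ hκ hγ D fX hchar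
  set c : ℤ_[p] := PowerSeries.constantCoeff fX with hc
  set T : ℕ := Nat.card (AddCommGroup.primaryComponent W.toAffine.Point p) with hT
  set E : ℕ := Nat.card (AddCommGroup.primaryComponent ((integralModelInt W).map (Int.castRingHom (ZMod p))).toAffine.Point p) with hE
  set S : ℕ := Nat.card (W.selmerGroupPInfty p) with hS
  set v : ℕ := padicValNat p W.tamagawaProduct with hv
  -- the right-hand side does not vanish
  have hE0 : E ≠ 0 := Nat.card_pos.ne'
  have hS0 : S ≠ 0 := Nat.card_pos.ne'
  have hp0 : (p : ℚ_[p]) ≠ 0 := by exact_mod_cast hp.out.ne_zero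
  have hu0 : ((u : ℤ_[p]) : ℚ_[p]) ≠ 0 := PadicInt.coe_ne_zero.mpr u.ne_zero
  have hE' : (E : ℚ_[p]) ≠ 0 := by exact_mod_cast hE0
  have hS' : (S : ℚ_[p]) ≠ 0 := by exact_mod_cast hS0
  have h1 : ((u : ℤ_[p]) : ℚ_[p]) * (p : ℚ_[p]) ^ v ≠ 0 := mul_ne_zero hu0 (pow_ne_zero _ hp0)
  have h2 : ((u : ℤ_[p]) : ℚ_[p]) * (p : ℚ_[p]) ^ v * (E : ℚ_[p]) ^ 2 ≠ 0 := mul_ne_zero h1 (pow_ne_zero _ hE')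
  have hR : ((u : ℤ_[p]) : ℚ_[p]) * (p : ℚ_[p]) ^ v * (E : ℚ_[p]) ^ 2 * (S : ℚ_[p]) ≠ 0 := mul_ne_zero h2 hS'
  have hL : (c : ℚ_[p]) * (T : ℚ_[p]) ^ 2 ≠ 0 := by rw [hu]; exact hR
  have hc0 : (c : ℚ_[p]) ≠ 0 := left_ne_zero_of_mul hL
  have hT2 : (T : ℚ_[p]) ^ 2 ≠ 0 := right_ne_zero_of_mul hL
  have hT' : (T : ℚ_[p]) ≠ 0 := fun h ↦ hT2 (by rw [h, zero_pow two_ne_zero])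
  have hT0 : T ≠ 0 := by exact_mod_cast hT'
  have hc0' : c ≠ 0 := PadicInt.coe_ne_zero.mp hc0
  -- valuations
  have hval := congrArg Padic.valuation hu
  rw [Padic.valuation_mul hc0 hT2, Padic.valuation_pow, Padic.valuation_natCast, PadicInt.valuation_coe,
    Padic.valuation_mul h2 hS', Padic.valuation_mul h1 (pow_ne_zero _ hE'), Padic.valuation_mul hu0 (pow_ne_zero _ hp0),
    valuation_coe_units, Padic.valuation_pow, Padic.valuation_p, Padic.valuation_pow, Padic.valuation_natCast, Padic.valuation_natCast] at hval
  refine ⟨hc0', hT0, ?_⟩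
  omega

end Valuation

/-! ## §2 The base term and the honest base number in closed form -/

section BaseTerm

/-- ★★★ **THE BASE TERM IN CLOSED FORM: `#Sel_{p^∞}(W/ℚ_∞)^Γ · p^{2t} = p^{v + 2e + s} · #(F/TF)`** — `W/ℚ` globally minimal, good ORDINARY at `p` (ANY `p`), `κ` cyclotomic with topological
generator `γ`, `D` any dual datum (torsion by the tree), `Sel_{p^∞}(W/ℚ)` finite, `F ≤ X` finite with `X/F` free of finite submodules. Greenberg's Lemma 4.2 (`#S^Γ = p^{ord_p f(0)}·#S_Γ`, gen 60's
kernel form) × Thm. 4.1 (kernel). [cite: GreenbergLNM1716, §4 Thm. 4.1, Lemma 4.2 (pp. 102–103)] [cite: Washington1997, §13.3 Thm. 13.13] -/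
theorem natCard_selmerInvariants_zero_mul_pow_eq (hgo : GoodOrd W p) (hκ : κ.IsCyclotomic) (hγ : κ.IsTopGenerator γ) (D : W.SelmerDualData κ γ)
    [hSel : Finite (W.selmerGroupPInfty p)] (F : Submodule (IwasawaAlgebra p) D.X) [Finite F] (hF : ∀ N : Submodule (IwasawaAlgebra p) (D.X ⧸ F), Finite N → N = ⊥) :
    Nat.card ↥(W.selmerInfty κ ⊓ W.layerInvariants κ 0) * p ^ (2 * padicValNat p (Nat.card (AddCommGroup.primaryComponent W.toAffine.Point p))) =
      p ^ (padicValNat p W.tamagawaProduct + 2 * padicValNat p (Nat.card (AddCommGroup.primaryComponent ((integralModelInt W).map (Int.castRingHom (ZMod p))).toAffine.Point p)) +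
          padicValNat p (Nat.card (W.selmerGroupPInfty p))) *
        Nat.card (F ⧸ (Ideal.span {(PowerSeries.X : IwasawaAlgebra p)} • ⊤ : Submodule (IwasawaAlgebra p) F)) := by
  haveI : Module.Finite (IwasawaAlgebra p) D.X := D.module_finite_holds hγ
  have hD : D.IsTorsion := isTorsion W κ hgo hκ hγ D hSel
  obtain ⟨fX, -, hchar⟩ := exists_charGenerator_ne_zero D.X hD
  obtain ⟨h0, -, hval⟩ := constantCoeff_ne_zero_and_valuation_add_eq W κ hgo hκ hγ D hchar
  rw [natCard_selmerInvariants_zero_eq_pow_mul W κ hγ D hD F hF hchar h0, ← hval, pow_add]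
  ring

/-- ★★ **THE HONEST BASE NUMBER IN CLOSED FORM: `#Sel_{p^∞}(W/ℚ) · #ker g_0 · p^{2t} = p^{v + 2e + s} · #(F/TF) · #ker h_0`** (same hypotheses; `ker g_0 = A_0/Sel_0` Greenberg's control kernel at the
base, `ker h_0` the restriction kernel, `#ker h_0 = #W(ℚ)[p^∞]`-type count). Lemma 4.3 at the base (tree, exact `Nat.card` form) × §2. [cite: GreenbergLNM1716, §4 Thm. 4.1, Lemmas 4.2–4.3 (p. 103)] -/
theorem natCard_selmer_mul_kerG_zero_mul_pow_eq (hgo : GoodOrd W p) (hκ : κ.IsCyclotomic) (hγ : κ.IsTopGenerator γ) (D : W.SelmerDualData κ γ)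
    [hSel : Finite (W.selmerGroupPInfty p)] (F : Submodule (IwasawaAlgebra p) D.X) [Finite F] (hF : ∀ N : Submodule (IwasawaAlgebra p) (D.X ⧸ F), Finite N → N = ⊥) :
    Nat.card ↥(W.selmerGroupPInfty p) * Nat.card (W.KerG κ 0) * p ^ (2 * padicValNat p (Nat.card (AddCommGroup.primaryComponent W.toAffine.Point p))) =
      p ^ (padicValNat p W.tamagawaProduct + 2 * padicValNat p (Nat.card (AddCommGroup.primaryComponent ((integralModelInt W).map (Int.castRingHom (ZMod p))).toAffine.Point p)) +
          padicValNat p (Nat.card (W.selmerGroupPInfty p))) *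
        Nat.card (F ⧸ (Ideal.span {(PowerSeries.X : IwasawaAlgebra p)} • ⊤ : Submodule (IwasawaAlgebra p) F)) * Nat.card (W.layerToInfty κ 0).ker := by
  haveI : Module.Finite (IwasawaAlgebra p) D.X := D.module_finite_holds hγ
  have hD : D.IsTorsion := isTorsion W κ hgo hκ hγ D hSel
  obtain ⟨fX, -, hchar⟩ := exists_charGenerator_ne_zero D.X hD
  obtain ⟨h0, -, hval⟩ := constantCoeff_ne_zero_and_valuation_add_eq W κ hgo hκ hγ D hchar
  have h43 := natCard_selmerLayer_zero_mul_kerG_zero_eq W κ hγ D hD F hF hchar h0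
  rw [W.natCard_selmerLayer_zero_eq κ] at h43
  rw [h43, ← hval, pow_add]
  ring

end BaseTerm

/-! ## §3 `μ + 2t ≤ 𝔢`, with equality iff `λ = 0` -/

section Mu

/-- ★★★ **`μ(X(W/ℚ_∞)) + 2·ord_p #W(ℚ)[p^∞] ≤ ord_p Tam(W) + 2·ord_p #W̃(𝔽_p)[p^∞] + ord_p #Sel_{p^∞}(W/ℚ)`** — `W/ℚ` globally minimal, good ORDINARY at `p` (ANY `p`), `κ` cyclotomic with topological
generator `γ`, ANY dual datum, `Sel_{p^∞}(W/ℚ)` finite; print-free (`μ(f_X) ≤ ord_p f_X(0)`, gen 60 `…BaseRing.valuation_constantCoeff_eq_mu_add_and_le`, and `μ(f_X) = μ(X)` by the structure theorem).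
[cite: GreenbergLNM1716, Conj. 1.11, §4 Thm. 4.1 (p. 102)] [cite: Washington1997, §13.2] -/
theorem mu_add_le (hgo : GoodOrd W p) (hκ : κ.IsCyclotomic) (hγ : κ.IsTopGenerator γ) (D : W.SelmerDualData κ γ) [hSel : Finite (W.selmerGroupPInfty p)] :
    D.mu + 2 * padicValNat p (Nat.card (AddCommGroup.primaryComponent W.toAffine.Point p)) ≤
      padicValNat p W.tamagawaProduct + 2 * padicValNat p (Nat.card (AddCommGroup.primaryComponent ((integralModelInt W).map (Int.castRingHom (ZMod p))).toAffine.Point p)) +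
        padicValNat p (Nat.card (W.selmerGroupPInfty p)) := by
  haveI : Module.Finite (IwasawaAlgebra p) D.X := D.module_finite_holds hγ
  have hD : D.IsTorsion := isTorsion W κ hgo hκ hγ D hSel
  obtain ⟨fX, hfX, hchar⟩ := exists_charGenerator_ne_zero D.X hD
  obtain ⟨h0, -, hval⟩ := constantCoeff_ne_zero_and_valuation_add_eq W κ hgo hκ hγ D hchar
  have hmu : mu fX = D.mu := mu_generator_eq_muInvariant D.X hD hfX hchar
  have hle := (valuation_constantCoeff_eq_mu_add_and_le h0).2
  omega

/-- ★★★ **`μ + 2t = v + 2e + s ⟺ λ(X(W/ℚ_∞)) = 0`** (same hypotheses): the Euler weight is attained by `μ` exactly when the characteristic series has no distinguished part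
(`ord_p f_X(0) = μ(f_X) + ord_p f_X^{♭}(0)` and `f_X^{♭}(0) ∈ ℤ_pˣ ⟺ λ(f_X) = 0`, gen 60 `…BaseRing`). [cite: GreenbergLNM1716, Conj. 1.11, §4 Thm. 4.1] [cite: Washington1997, §7.1, §13.2] -/
theorem mu_add_eq_iff_lambda_eq_zero (hgo : GoodOrd W p) (hκ : κ.IsCyclotomic) (hγ : κ.IsTopGenerator γ) (D : W.SelmerDualData κ γ) [hSel : Finite (W.selmerGroupPInfty p)] :
    D.mu + 2 * padicValNat p (Nat.card (AddCommGroup.primaryComponent W.toAffine.Point p)) =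
      padicValNat p W.tamagawaProduct + 2 * padicValNat p (Nat.card (AddCommGroup.primaryComponent ((integralModelInt W).map (Int.castRingHom (ZMod p))).toAffine.Point p)) +
        padicValNat p (Nat.card (W.selmerGroupPInfty p)) ↔ D.lambda = 0 := by
  haveI : Module.Finite (IwasawaAlgebra p) D.X := D.module_finite_holds hγ
  have hD : D.IsTorsion := isTorsion W κ hgo hκ hγ D hSel
  obtain ⟨fX, hfX, hchar⟩ := exists_charGenerator_ne_zero D.X hD
  obtain ⟨h0, -, hval⟩ := constantCoeff_ne_zero_and_valuation_add_eq W κ hgo hκ hγ D hchar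
  have hmu : mu fX = D.mu := mu_generator_eq_muInvariant D.X hD hfX hchar
  have hlam : lam fX = D.lambda := lam_generator_eq_lambdaInvariant D.X hD hfX hchar
  have heq := (valuation_constantCoeff_eq_mu_add_and_le h0).1
  -- `λ(f_X) = 0 ⟺ #Λ/(f_X,T) = p^{μ(f_X)} ⟺ ord_p f_X(0) = μ(f_X)`
  have hiff : (PowerSeries.constantCoeff fX).valuation = mu fX ↔ lam fX = 0 := by
    rw [← natCard_quotient_span_sup_span_X_eq_pow_mu_iff h0, natCard_quotient_span_sup_span_X h0]
    exact (Nat.pow_right_injective hp.out.two_le).eq_iff.symm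
  rw [← hlam, ← hiff, ← hmu]
  omega

/-- ★★ **`λ(X(W/ℚ_∞)) ≠ 0 ⟹ μ + 2t < v + 2e + s`** (same hypotheses): one unit of the Euler weight at least is spent on the distinguished part. [cite: GreenbergLNM1716, Conj. 1.11, §4 Thm. 4.1] -/
theorem mu_add_lt_of_lambda_ne_zero (hgo : GoodOrd W p) (hκ : κ.IsCyclotomic) (hγ : κ.IsTopGenerator γ) (D : W.SelmerDualData κ γ) [hSel : Finite (W.selmerGroupPInfty p)]
    (hlam : D.lambda ≠ 0) :
    D.mu + 2 * padicValNat p (Nat.card (AddCommGroup.primaryComponent W.toAffine.Point p)) <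
      padicValNat p W.tamagawaProduct + 2 * padicValNat p (Nat.card (AddCommGroup.primaryComponent ((integralModelInt W).map (Int.castRingHom (ZMod p))).toAffine.Point p)) +
        padicValNat p (Nat.card (W.selmerGroupPInfty p)) :=
  lt_of_le_of_ne (mu_add_le W κ hgo hκ hγ D) fun h ↦ hlam ((mu_add_eq_iff_lambda_eq_zero W κ hgo hκ hγ D).mp h)

end Mu

/-! ## §4 The cell `W(ℚ)[p] = 0`: `t = 0`, `#ker h_0 = 1` -/

section Cell

omit [W.IsElliptic] [W.IsGloballyMinimal] hp in
/-- `W(ℚ)[p] = 0 ⟹ W(ℚ)[p^∞] = 0`: `#W(ℚ)[p^∞] = 1` (induction on the exponent). [folklore] -/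
theorem natCard_primaryComponent_eq_one_of_noPTorsion (hK : ∀ P : W.toAffine.Point, p • P = 0 → P = 0) :
    Nat.card (AddCommGroup.primaryComponent W.toAffine.Point p) = 1 := by
  -- `p^m • P = 0 ⟹ P = 0` by induction on `m`
  have key : ∀ (m : ℕ) (P : W.toAffine.Point), p ^ m • P = 0 → P = 0 := by
    intro m
    induction m with
    | zero => intro P hP; simpa using hP
    | succ m ih => intro P hP; rw [pow_succ', ← smul_smul] at hP; exact ih P (hK _ hP)
  rw [Nat.card_eq_one_iff_unique]
  refine ⟨⟨fun a b ↦ ?_⟩, ⟨0⟩⟩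
  have ha : a = 0 := by
    obtain ⟨n, hn⟩ := (AddCommGroup.mem_primaryComponent (G := W.toAffine.Point) (p := p)).mp a.2
    exact Subtype.ext (key n a hn)
  have hb : b = 0 := by
    obtain ⟨n, hn⟩ := (AddCommGroup.mem_primaryComponent (G := W.toAffine.Point) (p := p)).mp b.2
    exact Subtype.ext (key n b hn)
  rw [ha, hb]

/-- ★★ **On the cell `W(ℚ)[p] = 0`: `#Sel_{p^∞}(W/ℚ_∞)^Γ = p^{v + 2e + s} · #(F/TF)`** — the base term of the lineage for every good ordinary rank-`0` member of the cell, at every prime.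
[cite: GreenbergLNM1716, §4 Thm. 4.1, Lemma 4.2] -/
theorem natCard_selmerInvariants_zero_eq_cell (hgo : GoodOrd W p) (hκ : κ.IsCyclotomic) (hγ : κ.IsTopGenerator γ) (hK : ∀ P : W.toAffine.Point, p • P = 0 → P = 0)
    (D : W.SelmerDualData κ γ) [hSel : Finite (W.selmerGroupPInfty p)] (F : Submodule (IwasawaAlgebra p) D.X) [Finite F]
    (hF : ∀ N : Submodule (IwasawaAlgebra p) (D.X ⧸ F), Finite N → N = ⊥) :
    Nat.card ↥(W.selmerInfty κ ⊓ W.layerInvariants κ 0) =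
      p ^ (padicValNat p W.tamagawaProduct + 2 * padicValNat p (Nat.card (AddCommGroup.primaryComponent ((integralModelInt W).map (Int.castRingHom (ZMod p))).toAffine.Point p)) +
          padicValNat p (Nat.card (W.selmerGroupPInfty p))) *
        Nat.card (F ⧸ (Ideal.span {(PowerSeries.X : IwasawaAlgebra p)} • ⊤ : Submodule (IwasawaAlgebra p) F)) := by
  have h := natCard_selmerInvariants_zero_mul_pow_eq W κ hgo hκ hγ D F hF
  rwa [natCard_primaryComponent_eq_one_of_noPTorsion W hK, padicValNat_one_right, mul_zero, pow_zero, mul_one] at h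

/-- ★★ **On the cell `W(ℚ)[p] = 0`: `#Sel_{p^∞}(W/ℚ) · #ker g_0 = p^{v + 2e + s} · #(F/TF)`** — the honest base number of the `γ`-free door in closed form (`#ker h_0 = 1` on the cell, lineage
`…GrowthFiniteCell.natCard_ker_layerToInfty_eq_one`). [cite: GreenbergLNM1716, §4 Thm. 4.1, Lemmas 4.2–4.3] -/
theorem natCard_selmer_mul_kerG_zero_eq_cell (hgo : GoodOrd W p) (hκ : κ.IsCyclotomic) (hγ : κ.IsTopGenerator γ) (hK : ∀ P : W.toAffine.Point, p • P = 0 → P = 0)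
    (D : W.SelmerDualData κ γ) [hSel : Finite (W.selmerGroupPInfty p)] (F : Submodule (IwasawaAlgebra p) D.X) [Finite F]
    (hF : ∀ N : Submodule (IwasawaAlgebra p) (D.X ⧸ F), Finite N → N = ⊥) :
    Nat.card ↥(W.selmerGroupPInfty p) * Nat.card (W.KerG κ 0) =
      p ^ (padicValNat p W.tamagawaProduct + 2 * padicValNat p (Nat.card (AddCommGroup.primaryComponent ((integralModelInt W).map (Int.castRingHom (ZMod p))).toAffine.Point p)) +
          padicValNat p (Nat.card (W.selmerGroupPInfty p))) *
        Nat.card (F ⧸ (Ideal.span {(PowerSeries.X : IwasawaAlgebra p)} • ⊤ : Submodule (IwasawaAlgebra p) F)) := by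
  have h := natCard_selmer_mul_kerG_zero_mul_pow_eq W κ hgo hκ hγ D F hF
  -- `#ker h_0 = 1` on the cell (lineage, general `K`; the `DecidableEq ℚ` instance behind the group law is transported by `convert`)
  have hh : Nat.card (W.layerToInfty κ 0).ker = 1 := natCard_ker_layerToInfty_eq_one W κ (fun P hP ↦ hK P (by convert hP using 10)) 0
  rwa [natCard_primaryComponent_eq_one_of_noPTorsion W hK, padicValNat_one_right, mul_zero, pow_zero, mul_one, hh, mul_one] at h

/-- ★★ **On the cell `W(ℚ)[p] = 0`: `μ(X(W/ℚ_∞)) ≤ v + 2e + s`, with equality iff `λ = 0`.** [cite: GreenbergLNM1716, Conj. 1.11, §4 Thm. 4.1] -/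
theorem mu_le_cell (hgo : GoodOrd W p) (hκ : κ.IsCyclotomic) (hγ : κ.IsTopGenerator γ) (hK : ∀ P : W.toAffine.Point, p • P = 0 → P = 0)
    (D : W.SelmerDualData κ γ) [hSel : Finite (W.selmerGroupPInfty p)] :
    D.mu ≤ padicValNat p W.tamagawaProduct + 2 * padicValNat p (Nat.card (AddCommGroup.primaryComponent ((integralModelInt W).map (Int.castRingHom (ZMod p))).toAffine.Point p)) +
        padicValNat p (Nat.card (W.selmerGroupPInfty p)) ∧
      (D.mu = padicValNat p W.tamagawaProduct + 2 * padicValNat p (Nat.card (AddCommGroup.primaryComponent ((integralModelInt W).map (Int.castRingHom (ZMod p))).toAffine.Point p)) +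
        padicValNat p (Nat.card (W.selmerGroupPInfty p)) ↔ D.lambda = 0) := by
  have h1 := mu_add_le W κ hgo hκ hγ D
  have h2 := mu_add_eq_iff_lambda_eq_zero W κ hgo hκ hγ D
  rw [natCard_primaryComponent_eq_one_of_noPTorsion W hK, padicValNat_one_right, mul_zero, add_zero] at h1 h2
  exact ⟨h1, h2⟩

end Cell

/-! ## §5 `p = 2`: the seed cell of C2 — `2` is anomalous, the `γ`-free door is shut at the base; `μ₂ ≤ 𝔢`, `= ⟺ λ₂ = 0` -/

section Two

variable (W : WeierstrassCurve ℚ) [W.IsElliptic] [W.IsGloballyMinimal] (κ₂ : ZpExtension ℚ 2) {γ : Field.absoluteGaloisGroup ℚ}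

omit [W.IsElliptic] in
/-- At a good ORDINARY `2`, `#W̃(𝔽₂)[2^∞] = #W̃(𝔽₂) ∈ {2, 4}`: **`1 ≤ ord₂ #W̃(𝔽₂)[2^∞]`** (`a₂` odd). [cite: SilvermanAEC2009, V §1] -/
theorem one_le_padicValNat_natCard_primaryComponent_reduction_two (hgo : GoodOrd W 2) :
    1 ≤ padicValNat 2 (Nat.card (AddCommGroup.primaryComponent ((integralModelInt W).map (Int.castRingHom (ZMod 2))).toAffine.Point 2)) := by
  rw [natCard_primaryComponent_eq_pow_padicValNat 2, padicValNat.prime_pow]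
  have h2N : 2 ∣ W.reductionPointCount 2 := by
    have h := hgo.2
    simp only [WeierstrassCurve.frobeniusTrace] at h
    omega
  exact one_le_padicValNat_of_dvd (W.reductionPointCount_pos 2).ne' h2N

/-- ★★ **THE `γ`-FREE DOOR IS SHUT AT THE BASE OF EVERY SEED: `2^{v + s + 2} ∣ #Sel_{2^∞}(W/ℚ) · #ker g_0`**, hence `#Sel_{2^∞}(W/ℚ)·#ker g_0 ≥ 4 > 2^{2^0}` — `W/ℚ` globally minimal, good ORDINARY at `2`,
no rational `2`-torsion abscissa (C2's binder `∀ x, ¬ HasRationalTwoTorsionX W x`), `κ` cyclotomic with generator `γ`, `Sel_{2^∞}(W/ℚ)` finite (any dual datum `D` only fixes the module; the number is datum-free). The door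
`0 < #Sel_{2^∞}(W/ℚ_n)·#ker g_n < 2^{2ⁿ} ⟹ μ = 0` (gen 60) can therefore open only at layers `n ≥ 1`. [cite: GreenbergLNM1716, §4 Thm. 4.1, Lemmas 4.2–4.3] -/
theorem pow_dvd_natCard_selmer_mul_kerG_zero_two (hgo : GoodOrd W 2) (ht : ∀ x : ℚ, ¬ Greenberg1999.HasRationalTwoTorsionX W x) (hκ : κ₂.IsCyclotomic)
    (hγ : κ₂.IsTopGenerator γ) (D : W.SelmerDualData κ₂ γ) [hSel : Finite (W.selmerGroupPInfty 2)] :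
    2 ^ (padicValNat 2 W.tamagawaProduct + padicValNat 2 (Nat.card (W.selmerGroupPInfty 2)) + 2) ∣ Nat.card ↥(W.selmerGroupPInfty 2) * Nat.card (W.KerG κ₂ 0) ∧
      4 ≤ Nat.card ↥(W.selmerGroupPInfty 2) * Nat.card (W.KerG κ₂ 0) ∧ ¬ Nat.card ↥(W.selmerGroupPInfty 2) * Nat.card (W.KerG κ₂ 0) < 2 ^ (2 ^ 0) := by
  haveI : Module.Finite (IwasawaAlgebra 2) D.X := D.module_finite_holds hγ
  have hD : D.IsTorsion := isTorsion W κ₂ hgo hκ hγ D hSel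
  -- the maximal finite submodule exists (Noetherian, tree); its `T`-coinvariant order is a positive integer
  haveI : IsNoetherian (IwasawaAlgebra 2) D.X := inferInstance
  obtain ⟨F, hFfin, hFmax⟩ := exists_finite_submodule_forall_finite_le (R := IwasawaAlgebra 2) (M := D.X)
  haveI : Finite F := hFfin
  have hF := forall_finite_eq_bot_quotient_of_forall_finite_le F hFmax
  have h := natCard_selmer_mul_kerG_zero_eq_cell W κ₂ hgo hκ hγ (forall_two_nsmul_eq_zero W ht) D F hF
  have he := one_le_padicValNat_natCard_primaryComponent_reduction_two W hgo
  set e := padicValNat 2 (Nat.card (AddCommGroup.primaryComponent ((integralModelInt W).map (Int.castRingHom (ZMod 2))).toAffine.Point 2)) with he_def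
  haveI : Finite (F ⧸ (Ideal.span {(PowerSeries.X : IwasawaAlgebra 2)} • ⊤ : Submodule (IwasawaAlgebra 2) F)) := Finite.of_surjective _ (Submodule.mkQ_surjective _)
  have hFpos : 0 < Nat.card (F ⧸ (Ideal.span {(PowerSeries.X : IwasawaAlgebra 2)} • ⊤ : Submodule (IwasawaAlgebra 2) F)) := Nat.card_pos
  have hdvd : 2 ^ (padicValNat 2 W.tamagawaProduct + padicValNat 2 (Nat.card (W.selmerGroupPInfty 2)) + 2) ∣ Nat.card ↥(W.selmerGroupPInfty 2) * Nat.card (W.KerG κ₂ 0) := by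
    rw [h]
    refine Dvd.dvd.mul_right (pow_dvd_pow 2 ?_) _
    omega
  have h4 : 4 ≤ Nat.card ↥(W.selmerGroupPInfty 2) * Nat.card (W.KerG κ₂ 0) := by
    have hpos : 0 < Nat.card ↥(W.selmerGroupPInfty 2) * Nat.card (W.KerG κ₂ 0) := by rw [h]; positivity
    have := Nat.le_of_dvd hpos ((pow_dvd_pow 2 (by omega : 2 ≤ padicValNat 2 W.tamagawaProduct + padicValNat 2 (Nat.card (W.selmerGroupPInfty 2)) + 2)).trans hdvd)
    simpa using this
  exact ⟨hdvd, h4, by norm_num; omega⟩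

/-- ★★ **THE SEED READING: `μ₂(X(W/ℚ_∞)) ≤ ord₂ Tam(W) + 2·ord₂ #W̃(𝔽₂) + ord₂ #Sel_{2^∞}(W/ℚ)`, with EQUALITY iff `λ₂(X(W/ℚ_∞)) = 0`** — `W/ℚ` globally minimal, good ORDINARY at `2`, no rational `2`-torsion abscissa (C2's binder),
`κ` cyclotomic with generator `γ`, ANY dual datum, `Sel_{2^∞}(W/ℚ)` finite; print-free. Reading for C2: the right side is `≥ 2`; Mazur's main conjecture predicts `μ₂ = 0 < 𝔢` and `λ₂ = λ_an ≥ 1`; a seed with `λ₂ = 0`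
would have `μ₂ = 𝔢 ≥ 2`, i.e. would REFUTE stub T and C2 — so on the seed cell «`μ₂ = 0`» and «`λ₂ ≥ 1 ∧ μ₂ ≤ 𝔢 − 1`» are the only shapes a certificate can take.
[cite: GreenbergLNM1716, Conj. 1.11, §4 Thm. 4.1] [cite: Washington1997, §13.2] -/
theorem mu_le_seed (hgo : GoodOrd W 2) (ht : ∀ x : ℚ, ¬ Greenberg1999.HasRationalTwoTorsionX W x) (hκ : κ₂.IsCyclotomic) (hγ : κ₂.IsTopGenerator γ)
    (D : W.SelmerDualData κ₂ γ) [hSel : Finite (W.selmerGroupPInfty 2)] :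
    D.mu ≤ padicValNat 2 W.tamagawaProduct + 2 * padicValNat 2 (W.reductionPointCount 2) + padicValNat 2 (Nat.card (W.selmerGroupPInfty 2)) ∧
      (D.mu = padicValNat 2 W.tamagawaProduct + 2 * padicValNat 2 (W.reductionPointCount 2) + padicValNat 2 (Nat.card (W.selmerGroupPInfty 2)) ↔ D.lambda = 0) ∧
      2 ≤ padicValNat 2 W.tamagawaProduct + 2 * padicValNat 2 (W.reductionPointCount 2) + padicValNat 2 (Nat.card (W.selmerGroupPInfty 2)) := by
  have h := mu_le_cell W κ₂ hgo hκ hγ (forall_two_nsmul_eq_zero W ht) D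
  have he := one_le_padicValNat_natCard_primaryComponent_reduction_two W hgo
  have hN : Nat.card ((integralModelInt W).map (Int.castRingHom (ZMod 2))).toAffine.Point = W.reductionPointCount 2 := rfl
  rw [natCard_primaryComponent_eq_pow_padicValNat 2, padicValNat.prime_pow, hN] at h he
  exact ⟨h.1, h.2, by omega⟩

end Two

end Summit.BirchSwinnertonDyer.BirchSwinnertonDyer.Theorems.AlignedTransportAtTwoHalfDescentBaseIndexEuler

end
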